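import Literature.Geometry.Riemannian.SurgicalSolutions
import Literature.Geometry.Lorentzian.VolumeProofs
import HarnessLib

/-!
# The count of surgeries in Chen–Zhu's Theorem 5.6 (§5, p. 30 and p. 43 "Summing up")
(topic `Geometry/Riemannian`)

Layer RF6 of the decomposition of `Literature.Geometry.Riemannian.hamilton_chen_tang_zhu`, next to
`SurgicalSolutions.lean`, which renders the conclusion of **Chen–Zhu 2006, Thm. 5.6**
(J. Differential Geom. 74 (2006); arXiv:math/0504478, p. 43) over the predicate
`ChenZhuSurgicalFlowIn 𝔭 m M g₀ t₀ t₁` ("`(M, g₀)`, started at absolute time `t₀`, is carried to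
extinction at `t₁` by a solution of the Ricci flow with `m` surgeries satisfying the a priori
assumptions with parameters `𝔭`") and proves Thm. 1.1 (the structure statement
`∀ M g₀, … → ∃ m, ChenZhuResolvableIn m M g₀` of `SurgicalRicciFlow.lean`) from the statement of Thm. 5.6
(`chenZhu_ricciFlowWithSurgery_of_surgicalSolution_existence`). Thm. 5.6 itself is NOT a named
fact of the tree (D-0026: it is the whole analytic theory of the paper, of which Thm. 1.1 is an
eight-line corollary); its statement appears here verbatim as the CONCLUSION of
`chenZhu_surgicalSolution_existence_of_step`. This file PROVES the two elementary pieces of the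
proof of Thm. 5.6 that do not belong to the analysis of §§3–5, so that what remains of Thm. 5.6
(`chenZhu_surgicalSolution_existence_of_step`) is its analytic input —
the surgery at one singular time: Lemma 5.2, Lemma 5.3 (= Hamilton 1997, D3.1) and the
procedures (1)–(4) of pp. 29–30; the justification of the canonical neighbourhood assumption,
Prop. 5.4 with Lemma 5.5; the evolution of the volume, `dV/dt ≤ 0` for `R ≥ 0` — together with
the base of the induction (p. 26, the a priori assumptions for the smooth solution, cf.
`chenZhuAPriori_smoothSolution` of `SurgicalSolutions.lean`):

* **p. 30, the time bound.** "Denote the minimum of the scalar curvature at time `t` by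
  `R_min(t) > 0`. … `d/dt R_min(t) ≥ ½ R²_min(t)`. By integrating this inequality, we conclude that
  the maximal time `T` of any solution to the Ricci flow with `δ`-cutoff surgeries must be
  bounded by `2/R_min(0) < +∞`" — for ONE stage this is Topping's `R ≥ α/(1 - (2α/n)t)`
  (`ricciFlow_scalarCurvature_lowerBound`) and `T ≤ n/(2α)` (`ricciFlow_singularTime_le`) with
  `n = 4`; across stages one carries the integrated bound: a stage started at absolute time `t₀`
  with `R ≥ α/(1 - α t₀/2)` ends by absolute time `2/α` (`stage_endTime_le`) and keeps
  `R ≥ α/(1 - α(t₀ + t)/2)` (`stage_scalarCurvature_ge`), which is again the hypothesis for the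
  next stage once the surgery does not decrease the scalar curvature (p. 30: "the minimum of the
  scalar curvature … is achieved in the region unaffected by the surgeries").
* **p. 43, the count.** "Clearly, the upper derivative of the volume in time satisfies
  `dV/dt ≤ 0` since the scalar curvature is nonnegative. Thus `V(t) ≤ V(0)` for all `t ∈ [0, T)`.
  Also note that at each time `t_i`, the volume which is cut down by `δ(t_i)`-cutoff surgery is at
  least an amount of `h⁴(t_i)` with `h(t_i)` depending only on `δ(t_i)` and `r̃(t_i)` (by
  Lemma 5.2). Thus the set of the surgery times `{t_i}` must be finite." Over the finite-stage
  predicate `ChenZhuSurgicalFlowIn` (which cannot speak of a solution with a not yet finite set of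
  surgery times) the same count is an induction on the measure `2V/h⁴ + #components`: the theorem
  `ChenZhuSurgicalFlowIn.exists_of_step` takes an ARBITRARY predicate `Inv M g₀ t₀` ("admissible
  restart data at absolute time `t₀`", to be instantiated by the analytic input) and the
  hypothesis `ChenZhuSurgicalStepHyp 𝔭 T_max h Inv` that from admissible data the maximal flow
  runs with the a priori assumptions, ends by `T_max`, and at its singular time either the
  manifold is extinct (`IsUnionOfPieces`) or one surgery (`IsSurgeryStep`) leads to admissible
  data on `M'` with `Vol(M') + q h⁴ ≤ Vol(M)`, `#comp(M') ≤ #comp(M) + q` for the number `q` of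
  `δ`-cutoffs, and `#comp(M') < #comp(M)` if `q = 0`; it concludes
  `∃ m t₁, ChenZhuSurgicalFlowIn 𝔭 m M g₀ t₀ t₁ ∧ t₁ ≤ T_max` with the explicit bound
  `m ≤ 2 Vol(M, g₀)/h⁴ + #comp(M)`. The components term accounts for the singular times at which
  print performs no cutoff but only throws away whole components (p. 27: "the solution becomes
  extinct" on them; procedures (2)–(4), pp. 29–30: compact components of positive curvature
  operator, capped and double horns, components in `Ω ∖ Ω_σ`), which are stages of
  `ChenZhuSurgicalFlowIn` all the same; the factor `2` makes the measure drop by `≥ 1` when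
  `q ≥ 1` cutoffs add at most `q` components while removing volume `≥ q h⁴`.

Nothing here is a named fact: the analytic input enters only as the hypothesis of the proved
reduction, exactly as the statement of Thm. 5.6 enters
`chenZhu_ricciFlowWithSurgery_of_surgicalSolution_existence`; composing the two gives
`chenZhu_ricciFlowWithSurgery_of_step` (Thm. 1.1 from the base and the step).

## Main results

* `componentsOf_univ_finite` — a compact manifold has finitely many components;
  `vol_univ_lt_top` — and finite volume (from `riemannianVolume_lt_top_of_isCompact_holds`).
* `stage_endTime_le`, `stage_scalarCurvature_ge` — p. 30 for one stage started at `t₀`.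
* `ChenZhuSurgicalStepHyp` (the step hypothesis), `ChenZhuSurgicalFlowIn.exists_of_step` (p. 43),
  and the resulting reductions: `chenZhu_surgicalSolution_existence_of_step` (the statement of
  Thm. 5.6 from the base at time `0` and the step) and `chenZhu_ricciFlowWithSurgery_of_step`
  (hence Thm. 1.1; its structure statement is no longer a named fact — merged into
  `hamilton_chen_tang_zhu` by the review of 2026-08-15, `ChenZhuStructureFromClassification.lean`).

## References

* B.-L. Chen, X.-P. Zhu, *Ricci flow with surgery on four-manifolds with positive isotropic
  curvature*, J. Differential Geom. 74 (2006) 177–264, arXiv:math/0504478: §5, p. 27, pp. 29–30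
  (procedures (1)–(4), `T ≤ 2/R_min(0)`), p. 43 ("Summing up", Thm. 5.6). [ChenZhu2006]
* P. Topping, *Lectures on the Ricci flow*, LMS Lecture Note Series 325 (2006), Thm. 3.2.1,
  Cor. 3.2.4. [Topping2006]
-/

noncomputable section

open Bundle Set Function TopologicalSpace
open scoped Manifold ContDiff Topology ENNReal

namespace Literature.Geometry.Riemannian

open Lorentzian

universe u

/-- Local notation: `𝔼 n` is the model Euclidean space `EuclideanSpace ℝ (Fin n)`. -/
local notation "𝔼 " n:arg => EuclideanSpace ℝ (Fin n)

/-- Local notation: smooth pseudo-Riemannian metrics on the tangent bundle of a 4-manifold `M`. -/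
local notation "Metric₄ " M:arg =>
  PseudoRiemannianMetric (𝓡 4) ∞ (EuclideanSpace ℝ (Fin 4)) (TangentSpace (𝓡 4) : M → Type _)

/-- Local notation: covariant derivatives on the tangent bundle of a 4-manifold `M`. -/
local notation "Connection₄ " M:arg =>
  CovariantDerivative (𝓡 4) (EuclideanSpace ℝ (Fin 4)) (TangentSpace (𝓡 4) : M → Type _)

/-! ### Finitely many components, finite volume -/

section Finiteness

variable {M : Type u} [TopologicalSpace M] [CompactSpace M] [ChartedSpace (𝔼 4) M]

omit [CompactSpace M] in
/-- A manifold is locally connected, so its components are open. [folklore] -/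
theorem isOpen_of_mem_componentsOf_univ {C : Set M} (hC : C ∈ componentsOf (univ : Set M)) :
    IsOpen C := by
  haveI : LocallyConnectedSpace M := ChartedSpace.locallyConnectedSpace (𝔼 4) M
  obtain ⟨x, -, rfl⟩ := hC
  show IsOpen (connectedComponentIn univ x)
  rw [connectedComponentIn_univ]
  exact isOpen_connectedComponent

/-- **A compact manifold has finitely many connected components** (they are open and disjoint
and cover the compact space; equivalently the component space is compact and discrete).
[folklore] -/
theorem componentsOf_univ_finite : (componentsOf (univ : Set M)).Finite := by
  haveI : LocallyConnectedSpace M := ChartedSpace.locallyConnectedSpace (𝔼 4) M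
  haveI : DiscreteTopology (ConnectedComponents M) :=
    ConnectedComponents.discreteTopology_iff.mpr fun _ ↦ isOpen_connectedComponent
  haveI : CompactSpace (ConnectedComponents M) := Quotient.compactSpace
  haveI : Finite (ConnectedComponents M) := finite_of_compact_of_discrete
  refine (finite_range fun c : ConnectedComponents M ↦
    ((↑) : M → ConnectedComponents M) ⁻¹' {c}).subset ?_
  rintro _ ⟨x, -, rfl⟩
  refine ⟨(x : ConnectedComponents M), ?_⟩
  show ((↑) : M → ConnectedComponents M) ⁻¹' {(x : ConnectedComponents M)} =
    connectedComponentIn univ x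
  rw [connectedComponents_preimage_singleton, connectedComponentIn_univ]

/-- **A compact Riemannian manifold has finite volume**: `Vol_g(M) < ∞`, from the discharged
fact `riemannianVolume_lt_top_of_isCompact` of `Volume.lean` (compact sets have finite
Riemannian = Hausdorff measure). [cite: Federer1969, §3.2.46] -/
theorem vol_univ_lt_top [T2Space M] [IsManifold (𝓡 4) ∞ M] [MeasurableSpace M] [BorelSpace M]
    {g : Metric₄ M} (hg : g.IsRiemannian) : g.vol univ < ⊤ := by
  show g.riemVolume univ < ⊤
  rw [PseudoRiemannianMetric.riemVolume_eq hg]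
  exact riemannianVolume_lt_top_of_isCompact_holds (g.toContMDiffRiemannianMetric hg) le_rfl
    isCompact_univ

end Finiteness

/-! ### p. 30: the time bound `T ≤ 2/R_min(0)` carried across the stages -/

section TimeBound

variable (M : Type u) [TopologicalSpace M] [T2Space M] [SecondCountableTopology M] [CompactSpace M]
  [Nonempty M] [ChartedSpace (𝔼 4) M] [IsManifold (𝓡 4) ∞ M]

/-- **A stage started at absolute time `t₀` with `R ≥ α/(1 - α t₀/2)` ends by absolute time
`2/α`** (Chen–Zhu 2006, p. 30: "`d/dt R_min(t) ≥ ½ R²_min(t)`. By integrating this inequality, we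
conclude that the maximal time `T` of any solution to the Ricci flow with `δ`-cutoff surgeries
must be bounded by `2/R_min(0)`", the step from one stage to the next): for a Ricci flow of
Riemannian metrics on `[0, T)`, `T > 0`, on a nonempty closed 4-manifold whose initial scalar
curvature is at least `β = α/(1 - α t₀/2)` (`α > 0`, `α t₀ < 2`; `β` is the value at time `t₀` of
the solution `α/(1 - α t/2)` of `ẏ = ½ y²`, `y(0) = α`), Topping's `T ≤ 4/(2β) = 2/β = 2/α - t₀`
(`ricciFlow_singularTime_le`). [cite: ChenZhu2006, §5, p. 30] [cite: Topping2006, Cor. 3.2.4] -/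
theorem stage_endTime_le (h₂ : ricciFlow_singularTime_le.{0, 0, u}) {T : ℝ} (hT : 0 < T)
    (g : ℝ → Metric₄ M) (cov : ℝ → Connection₄ M) (hflow : IsRicciFlow g cov (Ico 0 T))
    (hR : ∀ t ∈ Ico 0 T, (g t).IsRiemannian) {α t₀ : ℝ} (hα : 0 < α) (ht₀ : α * t₀ < 2)
    (h0 : ∀ x : M, α / (1 - α * t₀ / 2) ≤ (g 0).scalarCurvatureWith (cov 0) x) :
    t₀ + T ≤ 2 / α := by
  have hD : 0 < 1 - α * t₀ / 2 := by linarith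
  have hβ : 0 < α / (1 - α * t₀ / 2) := div_pos hα hD
  have hT' := h₂ (𝓡 4) M T hT g cov hflow hR (α / (1 - α * t₀ / 2)) hβ h0
  have hrank : (Module.finrank ℝ (EuclideanSpace ℝ (Fin 4)) : ℝ) = 4 := by simp
  rw [hrank] at hT'
  have hαne : α ≠ 0 := hα.ne'
  have hDne : 1 - α * t₀ / 2 ≠ 0 := hD.ne'
  have key : (4 : ℝ) / (2 * (α / (1 - α * t₀ / 2))) = 2 / α - t₀ := by
    field_simp
    ring
  linarith [key ▸ hT']

/-- **The integrated bound `R ≥ α/(1 - α t/2)` persists through the stage, in absolute time**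
(Chen–Zhu 2006, p. 30, with Topping 2006, Thm. 3.2.1 = `ricciFlow_scalarCurvature_lowerBound`
on `[0, t]` and Cor. 3.2.4 for its proviso): under the hypotheses of `stage_endTime_le`, at every
local time `t ∈ [0, T)` of the stage `α (t₀ + t) < 2` and `R(·, t) ≥ α/(1 - α(t₀ + t)/2)` — the
hypothesis of `stage_endTime_le` for a next stage started at absolute time `t₀ + t`, as soon as
the surgery at that time does not decrease the scalar curvature.
[cite: ChenZhu2006, §5, p. 30] [cite: Topping2006, Thm. 3.2.1] -/
theorem stage_scalarCurvature_ge (h₁ : ricciFlow_scalarCurvature_lowerBound.{0, 0, u})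
    (h₂ : ricciFlow_singularTime_le.{0, 0, u}) {T : ℝ} (hT : 0 < T)
    (g : ℝ → Metric₄ M) (cov : ℝ → Connection₄ M) (hflow : IsRicciFlow g cov (Ico 0 T))
    (hR : ∀ t ∈ Ico 0 T, (g t).IsRiemannian) {α t₀ : ℝ} (hα : 0 < α) (ht₀ : α * t₀ < 2)
    (h0 : ∀ x : M, α / (1 - α * t₀ / 2) ≤ (g 0).scalarCurvatureWith (cov 0) x) :
    ∀ t ∈ Ico 0 T, α * (t₀ + t) < 2 ∧
      ∀ x : M, α / (1 - α * (t₀ + t) / 2) ≤ (g t).scalarCurvatureWith (cov t) x := by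
  intro t ht
  have hend : t₀ + T ≤ 2 / α := stage_endTime_le M h₂ hT g cov hflow hR hα ht₀ h0
  have hD : 0 < 1 - α * t₀ / 2 := by linarith
  have hαne : α ≠ 0 := hα.ne'
  have hDne : 1 - α * t₀ / 2 ≠ 0 := hD.ne'
  -- `α (t₀ + t) < 2` from `t < T ≤ 2/α - t₀`
  have hlt : α * (t₀ + t) < 2 := by
    have h' : t₀ + t < 2 / α := by linarith [ht.2]
    calc α * (t₀ + t) < α * (2 / α) := mul_lt_mul_of_pos_left h' hα
      _ = 2 := by field_simp
  have hD' : 0 < 1 - α * (t₀ + t) / 2 := by linarith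
  refine ⟨hlt, fun x ↦ ?_⟩
  -- Topping Thm. 3.2.1 on `[0, t]` with initial bound `β = α/(1 - α t₀/2)`
  have hsub : Icc 0 t ⊆ Ico 0 T := fun s hs ↦ ⟨hs.1, hs.2.trans_lt ht.2⟩
  have hβt : α / (1 - α * t₀ / 2) * t < 2 := by
    rw [div_mul_eq_mul_div, div_lt_iff₀ hD]
    nlinarith [ht.1]
  have hrank : (Module.finrank ℝ (EuclideanSpace ℝ (Fin 4)) : ℝ) = 4 := by simp
  have hprov : 0 < 1 - (2 * (α / (1 - α * t₀ / 2)) /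
      Module.finrank ℝ (EuclideanSpace ℝ (Fin 4))) * t := by
    rw [hrank]
    nlinarith [hβt]
  have hb := h₁ (𝓡 4) M t g cov (hflow.mono hsub) (fun s hs ↦ hR s (hsub hs))
    (α / (1 - α * t₀ / 2)) h0 t ⟨ht.1, le_rfl⟩ hprov x
  rw [hrank] at hb
  have hD'ne : 1 - α * (t₀ + t) / 2 ≠ 0 := hD'.ne'
  have hPne : 1 - 2 * (α / (1 - α * t₀ / 2)) / 4 * t ≠ 0 := by
    rw [hrank] at hprov
    exact hprov.ne'
  have key : α / (1 - α * t₀ / 2) / (1 - 2 * (α / (1 - α * t₀ / 2)) / 4 * t) =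
      α / (1 - α * (t₀ + t) / 2) := by
    have h2ne : (2 : ℝ) - α * t₀ ≠ 0 := (by linarith : (0 : ℝ) < 2 - α * t₀).ne'
    rw [div_div]
    congr 1
    field_simp
    ring
  linarith [key ▸ hb]

end TimeBound

/-! ### p. 43: finitely many surgeries -/

section Count

/-- **Admissible restart data**: the type of predicates `Inv M g₀ t₀` on closed 4-manifolds
(with a Borel structure, for the volumes) carrying a metric `g₀`, read at absolute time `t₀` —
the shape of the inductive hypothesis of §5 ("a solution on `[0, T)` satisfying the a priori
assumptions, going singular at `T`", after the surgery at `T`). [folklore] -/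
def ChenZhuRestartPred : Type 1 :=
  ∀ (M : Type) [TopologicalSpace M] [T2Space M] [SecondCountableTopology M] [CompactSpace M]
    [ChartedSpace (𝔼 4) M] [IsManifold (𝓡 4) ∞ M] [MeasurableSpace M] [BorelSpace M],
    Metric₄ M → ℝ → Prop

/-- **The step of the construction of §5 at one singular time, as a hypothesis** (Chen–Zhu 2006,
§5, pp. 27–30 and p. 43, the content of Lemma 5.2, Lemma 5.3, the surgery procedures (1)–(4),
Prop. 5.4 and `dV/dt ≤ 0`, in the form the count of p. 43 consumes): from admissible data
`(M, g₀)` at absolute time `t₀` the maximal Ricci flow `g` on `[0, T)` from `g₀` exists and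
satisfies the a priori assumptions with parameters `𝔭` started at `t₀` (`ChenZhuAPriori`), the
stage ends by absolute time `T_max` (`t₀ + T ≤ T_max`; p. 30, `T_max = 2/R_min(0)`, cf.
`stage_endTime_le`), and at the singular time EITHER the solution becomes extinct — `M` is a
finite union of pieces (`IsUnionOfPieces`, p. 27) — OR one surgery at time `T` (`IsSurgeryStep`)
produces admissible data `(M', g₀')` at absolute time `t₀ + T` with the accounting of p. 43: for
the number `q` of `δ`-cutoffs performed, `Vol(M', g₀') + q h⁴ ≤ Vol(M, g₀)` ("`V(t) ≤ V(0)`" along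
the stage and "the volume which is cut down by `δ(t_i)`-cutoff surgery is at least an amount of
`h⁴(t_i)`"), `#comp(M') ≤ #comp(M) + q` (a cutoff along one neck adds at most one component),
and if `q = 0` then `#comp(M') < #comp(M)` (a singular time without cutoffs only throws away
whole components, procedures (2)–(4)). Here `h > 0` is a uniform lower bound for Lemma 5.2's
`h(t)` on `[0, T_max]` (`h` non-increasing). [cite: ChenZhu2006, §5, p. 43 ("Summing up")] [cite: ChenZhu2006, §5, pp. 27–30] -/
def ChenZhuSurgicalStepHyp (𝔭 : ChenZhuAPrioriParams) (Tmax h : ℝ) (Inv : ChenZhuRestartPred) :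
    Prop :=
  ∀ (M : Type) [TopologicalSpace M] [T2Space M] [SecondCountableTopology M] [CompactSpace M]
    [ChartedSpace (𝔼 4) M] [IsManifold (𝓡 4) ∞ M] [MeasurableSpace M] [BorelSpace M]
    (g₀ : Metric₄ M) (t₀ : ℝ), Inv M g₀ t₀ →
    ∃ (g : ℝ → Metric₄ M) (cov : ℝ → Connection₄ M) (T : ℝ),
      IsMaximalRicciFlow g cov T ∧ g 0 = g₀ ∧ ChenZhuAPriori 𝔭 g cov T t₀ ∧ t₀ + T ≤ Tmax ∧
      (IsUnionOfPieces M ∨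
        ∃ (M' : Type) (_ : TopologicalSpace M') (_ : T2Space M') (_ : SecondCountableTopology M')
          (_ : CompactSpace M') (_ : ChartedSpace (𝔼 4) M') (_ : IsManifold (𝓡 4) ∞ M')
          (_ : MeasurableSpace M') (_ : BorelSpace M') (g₀' : Metric₄ M') (q : ℕ),
          IsSurgeryStep g T g₀' ∧ Inv M' g₀' (t₀ + T) ∧
          g₀'.vol univ + ENNReal.ofReal ((q : ℝ) * h ^ 4) ≤ g₀.vol univ ∧
          (componentsOf (univ : Set M')).ncard ≤ (componentsOf (univ : Set M)).ncard + q ∧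
          (1 ≤ q ∨ (componentsOf (univ : Set M')).ncard < (componentsOf (univ : Set M)).ncard))

/-- The arithmetic of the count: with `Vol' + q h⁴ ≤ Vol`, `c' ≤ c + q` and (`q ≥ 1` or `c' < c`)
the measure `2 Vol/h⁴ + c` drops by at least `1`. [folklore] -/
theorem surgeryMeasure_drop {v v' h : ℝ} {c c' q : ℕ} (hh : 0 < h)
    (hv : v' + q * h ^ 4 ≤ v) (hc : c' ≤ c + q) (hdrop : 1 ≤ q ∨ c' < c) :
    2 * v' / h ^ 4 + c' ≤ 2 * v / h ^ 4 + c - 1 := by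
  have h4 : 0 < h ^ 4 := by positivity
  have key : 2 * v' / h ^ 4 ≤ 2 * v / h ^ 4 - 2 * q := by
    rw [div_le_iff₀ h4, sub_mul, div_mul_cancel₀ _ h4.ne']
    nlinarith
  rcases hdrop with hq | hcc
  · have hq' : (1 : ℝ) ≤ q := by exact_mod_cast hq
    have hc' : (c' : ℝ) ≤ c + q := by exact_mod_cast hc
    linarith
  · have hcc' : (c' : ℝ) + 1 ≤ c := by exact_mod_cast hcc
    have hq0 : (0 : ℝ) ≤ q := Nat.cast_nonneg q
    linarith

/-- From `a + ofReal r ≤ b < ∞` in `ℝ≥0∞` to real numbers. [folklore] -/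
theorem toReal_add_le_of_add_ofReal_le {a b : ℝ≥0∞} {r : ℝ} (hr : 0 ≤ r) (hb : b ≠ ⊤)
    (h : a + ENNReal.ofReal r ≤ b) : a ≠ ⊤ ∧ a.toReal + r ≤ b.toReal := by
  have ha : a ≠ ⊤ := ne_top_of_le_ne_top hb (le_trans le_self_add h)
  refine ⟨ha, ?_⟩
  have := ENNReal.toReal_mono hb h
  rwa [ENNReal.toReal_add ha ENNReal.ofReal_ne_top, ENNReal.toReal_ofReal hr] at this

/-- **Finitely many surgeries** (Chen–Zhu 2006, §5, p. 43, "Summing up": "`V(t) ≤ V(0)` for all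
`t ∈ [0, T)`. Also note that at each time `t_i`, the volume which is cut down by
`δ(t_i)`-cutoff surgery is at least an amount of `h⁴(t_i)` … Thus the set of the surgery times
`{t_i}` must be finite. So we have proved the following long-time existence result
[Thm. 5.6]"), as the reduction of the existence statement of Thm. 5.6 to the step hypothesis
`ChenZhuSurgicalStepHyp 𝔭 T_max h Inv`: from any admissible data `(M, g₀)` at absolute time `t₀`
there is a solution with finitely many surgeries satisfying the a priori assumptions with
parameters `𝔭`, `ChenZhuSurgicalFlowIn 𝔭 m M g₀ t₀ t₁`, extinct at a time `t₁ ≤ T_max`, with at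
most `2 Vol(M, g₀)/h⁴ + #comp(M)` surgery times. Proof: induction on the integer part of the
measure `2 Vol/h⁴ + #comp`, which is finite (`vol_univ_lt_top`) and drops by `≥ 1` at each
non-extinct singular time (`surgeryMeasure_drop`); the stages are assembled by the recursion
defining `ChenZhuSurgicalFlowIn`. [cite: ChenZhu2006, §5, p. 43 ("Summing up", Thm. 5.6)] -/
theorem ChenZhuSurgicalFlowIn.exists_of_step {𝔭 : ChenZhuAPrioriParams} {Tmax h : ℝ}
    {Inv : ChenZhuRestartPred} (hh : 0 < h) (hstep : ChenZhuSurgicalStepHyp 𝔭 Tmax h Inv)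
    (M : Type) [TopologicalSpace M] [T2Space M] [SecondCountableTopology M] [CompactSpace M]
    [ChartedSpace (𝔼 4) M] [IsManifold (𝓡 4) ∞ M] [MeasurableSpace M] [BorelSpace M]
    (g₀ : Metric₄ M) (t₀ : ℝ) (hInv : Inv M g₀ t₀) :
    ∃ (m : ℕ) (t₁ : ℝ), ChenZhuSurgicalFlowIn 𝔭 m M g₀ t₀ t₁ ∧ t₁ ≤ Tmax ∧
      (m : ℝ) ≤ 2 * (g₀.vol univ).toReal / h ^ 4 + (componentsOf (univ : Set M)).ncard := by
  -- the measure is finite: `g₀ = g 0` is Riemannian, `M` is compact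
  have h4 : 0 < h ^ 4 := by positivity
  suffices key : ∀ (n : ℕ) (M : Type) [TopologicalSpace M] [T2Space M] [SecondCountableTopology M]
      [CompactSpace M] [ChartedSpace (𝔼 4) M] [IsManifold (𝓡 4) ∞ M] [MeasurableSpace M]
      [BorelSpace M] (g₀ : Metric₄ M) (t₀ : ℝ), Inv M g₀ t₀ → g₀.vol univ ≠ ⊤ →
      2 * (g₀.vol univ).toReal / h ^ 4 + (componentsOf (univ : Set M)).ncard < n + 1 →
      ∃ (m : ℕ) (t₁ : ℝ), ChenZhuSurgicalFlowIn 𝔭 m M g₀ t₀ t₁ ∧ t₁ ≤ Tmax ∧ m ≤ n by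
    obtain ⟨g, cov, T, hmax, hg0, -⟩ := hstep M g₀ t₀ hInv
    have hRiem : g₀.IsRiemannian := hg0 ▸ hmax.isRiemannian 0 hmax.zero_mem
    have hfin : g₀.vol univ ≠ ⊤ := (vol_univ_lt_top hRiem).ne
    set μ : ℝ := 2 * (g₀.vol univ).toReal / h ^ 4 + (componentsOf (univ : Set M)).ncard with hμ
    have hμ0 : 0 ≤ μ := by positivity
    obtain ⟨m, t₁, hflow, ht₁, hm⟩ := key ⌊μ⌋₊ M g₀ t₀ hInv hfin (Nat.lt_floor_add_one μ)
    exact ⟨m, t₁, hflow, ht₁, (Nat.cast_le.mpr hm).trans (Nat.floor_le hμ0)⟩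
  intro n
  induction n with
  | zero =>
    intro M _ _ _ _ _ _ _ _ g₀ t₀ hInv hfin hμ
    obtain ⟨g, cov, T, hmax, hg0, hap, hT, halt⟩ := hstep M g₀ t₀ hInv
    rcases halt with hext | ⟨M', i₁, i₂, i₃, i₄, i₅, i₆, i₇, i₈, g₀', q, -, -, hvol, hcomp, hdrop⟩
    · exact ⟨0, t₀ + T, ⟨g, cov, T, hmax, hg0, hap, rfl, hext⟩, hT, le_rfl⟩
    · -- a surgery would make the (nonnegative) measure negative
      exfalso
      obtain ⟨-, hv⟩ := toReal_add_le_of_add_ofReal_le (by positivity) hfin hvol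
      have hd := surgeryMeasure_drop (c := (componentsOf (univ : Set M)).ncard)
        (c' := (componentsOf (univ : Set M')).ncard) hh hv hcomp hdrop
      have hnonneg : (0 : ℝ) ≤ 2 * (g₀'.vol univ).toReal / h ^ 4 +
          (componentsOf (univ : Set M')).ncard := by positivity
      push_cast at hμ
      linarith
  | succ n ih =>
    intro M _ _ _ _ _ _ _ _ g₀ t₀ hInv hfin hμ
    obtain ⟨g, cov, T, hmax, hg0, hap, hT, halt⟩ := hstep M g₀ t₀ hInv
    rcases halt with hext |
      ⟨M', i₁, i₂, i₃, i₄, i₅, i₆, i₇, i₈, g₀', q, hsurg, hInv', hvol, hcomp, hdrop⟩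
    · exact ⟨0, t₀ + T, ⟨g, cov, T, hmax, hg0, hap, rfl, hext⟩, hT, Nat.zero_le _⟩
    · obtain ⟨hfin', hv⟩ := toReal_add_le_of_add_ofReal_le (by positivity) hfin hvol
      have hd := surgeryMeasure_drop (c := (componentsOf (univ : Set M)).ncard)
        (c' := (componentsOf (univ : Set M')).ncard) hh hv hcomp hdrop
      have hμ' : 2 * (g₀'.vol univ).toReal / h ^ 4 + (componentsOf (univ : Set M')).ncard <
          n + 1 := by
        push_cast at hμ
        linarith
      obtain ⟨m, t₁, hflow', ht₁, hm⟩ := ih M' g₀' (t₀ + T) hInv' hfin' hμ'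
      refine ⟨m + 1, t₁, ?_, ht₁, by omega⟩
      exact ⟨g, cov, T, hmax, hg0, hap, M', i₁, i₂, i₃, i₄, i₅, i₆, i₇, i₈, g₀', hsurg, hflow'⟩

/-- **The number of surgeries from simply connected data** — the case of Thm. 5.6 (`M` simply
connected, hence connected: one component): at most `2 Vol(M, g₀)/h⁴ + 1` surgery times.
[cite: ChenZhu2006, §5, p. 43] -/
theorem ChenZhuSurgicalFlowIn.exists_of_step_of_connected {𝔭 : ChenZhuAPrioriParams}
    {Tmax h : ℝ} {Inv : ChenZhuRestartPred} (hh : 0 < h)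
    (hstep : ChenZhuSurgicalStepHyp 𝔭 Tmax h Inv)
    (M : Type) [TopologicalSpace M] [T2Space M] [SecondCountableTopology M] [CompactSpace M]
    [ChartedSpace (𝔼 4) M] [IsManifold (𝓡 4) ∞ M] [MeasurableSpace M] [BorelSpace M]
    [ConnectedSpace M] (g₀ : Metric₄ M) (t₀ : ℝ) (hInv : Inv M g₀ t₀) :
    ∃ (m : ℕ) (t₁ : ℝ), ChenZhuSurgicalFlowIn 𝔭 m M g₀ t₀ t₁ ∧ t₁ ≤ Tmax ∧
      (m : ℝ) ≤ 2 * (g₀.vol univ).toReal / h ^ 4 + 1 := by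
  obtain ⟨m, t₁, hflow, ht₁, hm⟩ := ChenZhuSurgicalFlowIn.exists_of_step hh hstep M g₀ t₀ hInv
  refine ⟨m, t₁, hflow, ht₁, hm.trans ?_⟩
  have hone : componentsOf (univ : Set M) = {univ} := by
    obtain ⟨x⟩ := (inferInstance : Nonempty M)
    apply Subset.antisymm
    · rintro _ ⟨y, -, rfl⟩
      show connectedComponentIn univ y ∈ ({univ} : Set (Set M))
      rw [mem_singleton_iff, connectedComponentIn_univ,
        PreconnectedSpace.connectedComponent_eq_univ]
    · rintro _ rfl
      refine ⟨x, mem_univ _, ?_⟩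
      show connectedComponentIn univ x = univ
      rw [connectedComponentIn_univ, PreconnectedSpace.connectedComponent_eq_univ]
  rw [hone, ncard_singleton]
  push_cast
  exact le_rfl

/-- **What remains of Thm. 5.6.** The statement of Chen–Zhu's Thm. 5.6 (p. 43) in the tree's
rendering — with the quantifier prefix of the a priori assumptions (p. 26: `η` universal, a
smallness threshold `ε₀` for the accuracy, `C₁, C₂` depending only on `ε`, then, given the simply
connected PIC manifold `(M, g₀)`, pinching constants `ρ, Λ, P` and the parameter `r̃`), a solution
with finitely many surgeries satisfying the a priori assumptions started at time `0`
(`ChenZhuSurgicalFlowIn`, `SurgicalSolutions.lean`), extinct at a time `T ≤ 2/α` for every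
positive lower bound `α` of `R(g₀)` (p. 30) — follows as soon as one has admissible restart data
`Inv` containing `(M, g₀)` at time `0` — the base of the induction, p. 26: "It follows from
Lemma 2.1 and Theorem 4.1 that the a priori assumptions above hold for the smooth solution on
`[0, T₀)`" (cf. `chenZhuAPriori_smoothSolution`) — for which the step `ChenZhuSurgicalStepHyp`
holds with some `h > 0` and a bound `T_max ≤ 2/α`. The count `ChenZhuSurgicalFlowIn.exists_of_step`
then yields the solution with finitely many surgeries, extinct by `T_max`. The conclusion is,
verbatim, the hypothesis of `chenZhu_ricciFlowWithSurgery_of_surgicalSolution_existence`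
(Thm. 5.6 ⇒ Thm. 1.1); Thm. 5.6 is deliberately not a named fact (module docstring).
[cite: ChenZhu2006, §5, p. 43 (Thm. 5.6)] [cite: ChenZhu2006, §5, p. 26 and p. 30] -/
theorem chenZhu_surgicalSolution_existence_of_step
    (H : ∃ η : ℝ, 0 < η ∧ ∃ ε₀ : ℝ, 0 < ε₀ ∧ ∀ ε : ℝ, 0 < ε → ε ≤ ε₀ →
      ∃ C₁ C₂ : ℝ, 0 < C₁ ∧ 0 < C₂ ∧
      ∀ (M : Type) [TopologicalSpace M] [T2Space M] [SecondCountableTopology M] [CompactSpace M]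
        [ChartedSpace (EuclideanSpace ℝ (Fin 4)) M] [IsManifold (𝓡 4) ∞ M]
        [SimplyConnectedSpace M] [MeasurableSpace M] [BorelSpace M] (g₀ : Metric₄ M),
        g₀.IsRiemannian → g₀.HasPositiveIsotropicCurvature →
          ∃ ρ Λ P : ℝ, 0 < ρ ∧ 0 < Λ ∧ 0 < P ∧
            ∃ r : ℝ → ℝ, (∀ t ∈ Ici (0 : ℝ), 0 < r t) ∧ AntitoneOn r (Ici 0) ∧
              ∃ (Inv : ChenZhuRestartPred) (h Tmax : ℝ), 0 < h ∧ Inv M g₀ 0 ∧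
                ChenZhuSurgicalStepHyp ⟨ε, C₁, C₂, η, ρ, Λ, P, r⟩ Tmax h Inv ∧
                ∀ (cov₀ : Connection₄ M) (α : ℝ), g₀.IsLeviCivita cov₀ → 0 < α →
                  (∀ x : M, α ≤ g₀.scalarCurvatureWith cov₀ x) → Tmax ≤ 2 / α) :
    ∃ η : ℝ, 0 < η ∧ ∃ ε₀ : ℝ, 0 < ε₀ ∧ ∀ ε : ℝ, 0 < ε → ε ≤ ε₀ → ∃ C₁ C₂ : ℝ, 0 < C₁ ∧ 0 < C₂ ∧
      ∀ (M : Type) [TopologicalSpace M] [T2Space M] [SecondCountableTopology M] [CompactSpace M]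
        [ChartedSpace (EuclideanSpace ℝ (Fin 4)) M] [IsManifold (𝓡 4) ∞ M] [SimplyConnectedSpace M]
        [MeasurableSpace M] [BorelSpace M]
        (g₀ : PseudoRiemannianMetric (𝓡 4) ∞ (EuclideanSpace ℝ (Fin 4))
          (TangentSpace (𝓡 4) : M → Type _)),
        g₀.IsRiemannian → g₀.HasPositiveIsotropicCurvature →
          ∃ ρ Λ P : ℝ, 0 < ρ ∧ 0 < Λ ∧ 0 < P ∧
            ∃ r : ℝ → ℝ, (∀ t ∈ Ici (0 : ℝ), 0 < r t) ∧ AntitoneOn r (Ici 0) ∧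
              ∃ (m : ℕ) (T : ℝ), ChenZhuSurgicalFlowIn ⟨ε, C₁, C₂, η, ρ, Λ, P, r⟩ m M g₀ 0 T ∧
                ∀ (cov₀ : CovariantDerivative (𝓡 4) (EuclideanSpace ℝ (Fin 4))
                    (TangentSpace (𝓡 4) : M → Type _)) (α : ℝ),
                  g₀.IsLeviCivita cov₀ → 0 < α → (∀ x : M, α ≤ g₀.scalarCurvatureWith cov₀ x) →
                    T ≤ 2 / α := by
  obtain ⟨η, hη, ε₀, hε₀, Hε⟩ := H
  refine ⟨η, hη, ε₀, hε₀, fun ε hε hεε₀ ↦ ?_⟩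
  obtain ⟨C₁, C₂, hC₁, hC₂, HM⟩ := Hε ε hε hεε₀
  refine ⟨C₁, C₂, hC₁, hC₂, fun M _ _ _ _ _ _ _ _ _ g₀ hg₀ hpic ↦ ?_⟩
  obtain ⟨ρ, Λ, P, hρ, hΛ, hP, r, hr, hanti, Inv, h, Tmax, hh, hInv, hstep, hTmax⟩ :=
    HM M g₀ hg₀ hpic
  obtain ⟨m, T, hflow, hT, -⟩ := ChenZhuSurgicalFlowIn.exists_of_step hh hstep M g₀ 0 hInv
  exact ⟨ρ, Λ, P, hρ, hΛ, hP, r, hr, hanti, m, T, hflow,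
    fun cov₀ α hLC hα hαR ↦ hT.trans (hTmax cov₀ α hLC hα hαR)⟩

/-- **Thm. 1.1 from the base and the step** (Chen–Zhu 2006, p. 43: Thm. 5.6, then "the main
theorem (Theorem 1.1) stated in Section 1 is a direct consequence of the above theorem"): under
the hypothesis of `chenZhu_surgicalSolution_existence_of_step`, the structure statement of Thm. 1.1
(`∃ m, ChenZhuResolvableIn m M g₀` for every closed simply connected PIC `(M, g₀)`) holds — the
count composed with the proved reduction
`chenZhu_ricciFlowWithSurgery_of_surgicalSolution_existence` (Thm. 5.6 ⇒ Thm. 1.1,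
`SurgicalSolutions.lean`). This is the tree's analytic path to Thm. 1.1 (and through the bridge
`hamilton_chen_tang_zhu_of_chenZhu_of_cerf` to `hamilton_chen_tang_zhu`):
what it asks for is the base (`exists_first_stage_chenZhuAPriori`, `SurgicalSolutionsBase.lean`)
and the analytic surgery step. [cite: ChenZhu2006, §5, p. 43 (Thm. 5.6 and Thm. 1.1)] -/
theorem chenZhu_ricciFlowWithSurgery_of_step
    (H : ∃ η : ℝ, 0 < η ∧ ∃ ε₀ : ℝ, 0 < ε₀ ∧ ∀ ε : ℝ, 0 < ε → ε ≤ ε₀ →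
      ∃ C₁ C₂ : ℝ, 0 < C₁ ∧ 0 < C₂ ∧
      ∀ (M : Type) [TopologicalSpace M] [T2Space M] [SecondCountableTopology M] [CompactSpace M]
        [ChartedSpace (EuclideanSpace ℝ (Fin 4)) M] [IsManifold (𝓡 4) ∞ M]
        [SimplyConnectedSpace M] [MeasurableSpace M] [BorelSpace M] (g₀ : Metric₄ M),
        g₀.IsRiemannian → g₀.HasPositiveIsotropicCurvature →
          ∃ ρ Λ P : ℝ, 0 < ρ ∧ 0 < Λ ∧ 0 < P ∧
            ∃ r : ℝ → ℝ, (∀ t ∈ Ici (0 : ℝ), 0 < r t) ∧ AntitoneOn r (Ici 0) ∧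
              ∃ (Inv : ChenZhuRestartPred) (h Tmax : ℝ), 0 < h ∧ Inv M g₀ 0 ∧
                ChenZhuSurgicalStepHyp ⟨ε, C₁, C₂, η, ρ, Λ, P, r⟩ Tmax h Inv ∧
                ∀ (cov₀ : Connection₄ M) (α : ℝ), g₀.IsLeviCivita cov₀ → 0 < α →
                  (∀ x : M, α ≤ g₀.scalarCurvatureWith cov₀ x) → Tmax ≤ 2 / α) :
    ∀ (M : Type) [TopologicalSpace M] [T2Space M] [SecondCountableTopology M]
      [CompactSpace M] [ChartedSpace (EuclideanSpace ℝ (Fin 4)) M] [IsManifold (𝓡 4) ∞ M]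
      [SimplyConnectedSpace M]
      (g₀ : Literature.Geometry.Lorentzian.PseudoRiemannianMetric (𝓡 4) ∞
        (EuclideanSpace ℝ (Fin 4)) (TangentSpace (𝓡 4) : M → Type _)),
      g₀.IsRiemannian → g₀.HasPositiveIsotropicCurvature → ∃ m : ℕ, ChenZhuResolvableIn m M g₀ :=
  chenZhu_ricciFlowWithSurgery_of_surgicalSolution_existence
    (chenZhu_surgicalSolution_existence_of_step H)

end Count

end Literature.Geometry.Riemannian

end
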